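import Literature.Analysis.FluidPDE.PineauVicolPressureDecayClass
import HarnessLib

/-!
# Kernel estimates for the Riesz pressure of a bounded field: decay of `D³Γ∞` and the
# `L¹` translation modulus of `D²Γ∞`

Analysis/FluidPDE support file (all results proved; no definitions, no named facts). The
pressure of a **bounded** (not square-integrable, not decaying) velocity field — the setting of
bounded mild / Type-I-in-time ancient solutions of Koch–Nadirashvili–Seregin–Šverák 2009, §3–§4,
where `p = RᵢRⱼ(uᵢuⱼ)` is determined only **modulo constants** — is built in
`RieszPressureModConst.lean` from the tree's near/far splitting `Γ = Γ₀ + Γ∞` of the Newtonian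
kernel (`NewtonKernel`, `PressureRepresentation`) with the far kernel taken modulo its value at a
base point: `∫ (D²Γ∞(x−y) − D²Γ∞(x₀−y))(v y, v y) dy`. Convergence of that integral for bounded
`v` rests on two kernel facts proved here:

* `exists_hasDecay_four_fderiv3_newtonFar` — `‖D³Γ∞(z)‖ ≤ M (1+|z|)⁻⁴` (off the ball `D³Γ∞ = D³Γ`
  is homogeneous of degree `−4`; inside it is bounded), so `D³Γ∞ ∈ L¹(ℝ³)`;
* `exists_norm_fderiv2_newtonFar_sub_sub_le` — the mean-value majorant
  `‖D²Γ∞(x−y) − D²Γ∞(x'−y)‖ ≤ M (1+ρ)⁴ ‖x−x'‖ (1+|y|)⁻⁴` for `|x|, |x'| ≤ ρ` (Peetre);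
* `exists_integral_norm_fderiv2_newtonFar_translate_sub_le` — the **`L¹` translation modulus**
  `∫ ‖D²Γ∞(z+d) − D²Γ∞(z)‖ dz ≤ A √(1+|d|)` (the true order is `log |d|`; the square root is what
  the elementary splitting `|z| ≷ 2(1+|d|)` with the weights `(1+|z|)^{-7/2}` gives, and is all the
  pressure identification needs: growth `o(|d|)`).

## References

* G. Koch, N. Nadirashvili, G. Seregin, V. Šverák, *Liouville theorems for the Navier–Stokes
  equations and applications*, Acta Math. 203 (2009) 83–105 = arXiv:0709.3599, §3–§4 (the
  pressure of bounded mild solutions modulo constants). [KochNadirashviliSereginSverak2009]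
* D. Gilbarg, N. S. Trudinger, *Elliptic PDE of Second Order* (2001), (2.13), Lemma 4.2 (the
  Newtonian kernel and its derivatives). [GilbargTrudinger2001]

## Mathlib / tree search

Tree: `exists_hasDecay_fderiv_newtonFar` (decay `(1+|z|)⁻³` of `D²Γ∞, D³Γ∞, D⁴Γ∞`),
`exists_decay_of_homogeneous`, `fderiv3_newtonKernel_homogeneous`, `newtonFar_fderiv_iterates_eq`,
`hasDecay_three_of_eqOn_far` (`PineauVicolPressureDecayClass`, `NewtonKernel`). Mathlib:
`integrable_one_add_norm`, `Convex.norm_image_sub_le_of_norm_fderiv_le`,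
`integral_add_right_eq_self`.
-/

noncomputable section

open MeasureTheory Set Filter Metric Topology InnerProductSpace Function
open scoped RealInnerProductSpace ContDiff ENNReal

namespace Literature.Analysis.FluidPDE

namespace RieszPressureModConst

open Literature.Analysis.FluidPDE.FourierNS (HasDecay)
open Literature.Analysis.FluidPDE.PineauVicol2026


-- nested operator types `ℝ³ →L[ℝ] ℝ³ →L[ℝ] ℝ³ →L[ℝ] ℝ`
set_option maxSynthPendingDepth 3

variable {F : Type*} [NormedAddCommGroup F] [NormedSpace ℝ F]

/-! ### Integrable weights on `ℝ³` -/

/-- `(1 + |y|)⁻⁴` is integrable on `ℝ³` (private helper). [folklore] -/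
private theorem integrable_inv_one_add_norm_pow_four : Integrable fun y : (EuclideanSpace ℝ (Fin 3)) => ((1 + ‖y‖) ^ 4)⁻¹ := by
  have h := integrable_one_add_norm (E := (EuclideanSpace ℝ (Fin 3))) (μ := volume) (r := 4) (by simp; norm_num)
  refine h.congr (Eventually.of_forall fun y => ?_)
  have h0 : 0 < 1 + ‖y‖ := by positivity
  show (1 + ‖y‖) ^ (-(4 : ℝ)) = ((1 + ‖y‖) ^ 4)⁻¹
  rw [Real.rpow_neg h0.le, show (4 : ℝ) = ((4 : ℕ) : ℝ) by norm_num, Real.rpow_natCast]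

/-- `(1 + |y|)^{-7/2}`, written `((1+|y|)³ √(1+|y|))⁻¹`, is integrable on `ℝ³` (private helper). [folklore] -/
private theorem integrable_inv_one_add_norm_pow_three_mul_sqrt :
    Integrable fun y : (EuclideanSpace ℝ (Fin 3)) => ((1 + ‖y‖) ^ 3 * Real.sqrt (1 + ‖y‖))⁻¹ := by
  have h := integrable_one_add_norm (E := (EuclideanSpace ℝ (Fin 3))) (μ := volume) (r := 7 / 2) (by simp; norm_num)
  refine h.congr (Eventually.of_forall fun y => ?_)
  have h0 : 0 < 1 + ‖y‖ := by positivity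
  show (1 + ‖y‖) ^ (-(7 / 2 : ℝ)) = ((1 + ‖y‖) ^ 3 * Real.sqrt (1 + ‖y‖))⁻¹
  rw [Real.rpow_neg h0.le, show (7 / 2 : ℝ) = ((3 : ℕ) : ℝ) + 1 / 2 by norm_num,
    Real.rpow_add h0, Real.rpow_natCast, Real.sqrt_eq_rpow]

/-- The elementary inequality `(1+t)⁻⁴ ≤ (1+s)^{-1/2} · ((1+t)³√(1+t))⁻¹` for `0 ≤ s ≤ t`
(used on the far region `|z| ≥ 2(1+|d|)`; private helper). [folklore] -/
private theorem inv_pow_four_le_of_le {s t : ℝ} (hs : 0 ≤ s) (hst : s ≤ t) :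
    ((1 + t) ^ 4)⁻¹ ≤ (Real.sqrt (1 + s))⁻¹ * ((1 + t) ^ 3 * Real.sqrt (1 + t))⁻¹ := by
  have h1 : 0 < 1 + t := by linarith
  have h2 : 0 < Real.sqrt (1 + s) := Real.sqrt_pos.2 (by linarith)
  have h3 : 0 < Real.sqrt (1 + t) := Real.sqrt_pos.2 h1
  have h4 : Real.sqrt (1 + s) ≤ Real.sqrt (1 + t) := Real.sqrt_le_sqrt (by linarith)
  rw [← mul_inv, inv_le_inv₀ (by positivity) (by positivity)]
  have h5 : Real.sqrt (1 + t) * Real.sqrt (1 + t) = 1 + t := Real.mul_self_sqrt h1.le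
  calc Real.sqrt (1 + s) * ((1 + t) ^ 3 * Real.sqrt (1 + t))
      ≤ Real.sqrt (1 + t) * ((1 + t) ^ 3 * Real.sqrt (1 + t)) := by gcongr
    _ = (1 + t) ^ 3 * (Real.sqrt (1 + t) * Real.sqrt (1 + t)) := by ring
    _ = (1 + t) ^ 4 := by rw [h5]; ring

/-- The elementary inequality `(1+t)⁻³ ≤ √(1+s) · ((1+t)³√(1+t))⁻¹` for `0 ≤ t ≤ s`, `-1 < t`
(used on the near region; private helper). [folklore] -/
private theorem inv_pow_three_le_of_le {s t : ℝ} (ht : -1 < t) (hts : t ≤ s) :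
    ((1 + t) ^ 3)⁻¹ ≤ Real.sqrt (1 + s) * ((1 + t) ^ 3 * Real.sqrt (1 + t))⁻¹ := by
  have h1 : 0 < 1 + t := by linarith
  have h3 : 0 < Real.sqrt (1 + t) := Real.sqrt_pos.2 h1
  have h4 : Real.sqrt (1 + t) ≤ Real.sqrt (1 + s) := Real.sqrt_le_sqrt (by linarith)
  rw [show Real.sqrt (1 + s) * ((1 + t) ^ 3 * Real.sqrt (1 + t))⁻¹ =
      Real.sqrt (1 + s) / Real.sqrt (1 + t) * ((1 + t) ^ 3)⁻¹ by field_simp]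
  refine le_mul_of_one_le_left (by positivity) ?_
  rwa [one_le_div h3]

/-! ### Decay `(1+|z|)⁻⁴` of `D³Γ∞` -/

omit [NormedSpace ℝ F] in
/-- **From a far-field identification to `HasDecay 4`.** If `Ψ` is continuous, agrees with `Φ`
off the ball of radius `r`, and `‖Φ z‖ ≤ M |z|^m` for `|z| ≥ 1` with `m ≤ −4`, then
`‖Ψ z‖ ≤ M'/(1+|z|)⁴` for all `z` (the order-four twin of the tree's
`hasDecay_three_of_eqOn_far`; the pattern of Gilbarg–Trudinger's derivative estimates (2.14) for the
Newtonian kernel, `|D^βΓ(z)| ≤ C|z|^{2−n−|β|}`). [cite: GilbargTrudinger2001, (2.14)] -/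
theorem hasDecay_four_of_eqOn_far {Ψ Φ : (EuclideanSpace ℝ (Fin 3)) → F} (hΨ : Continuous Ψ) {r : ℝ} (hr : 0 ≤ r)
    (heq : ∀ z, r < ‖z‖ → Ψ z = Φ z) {M : ℝ} (hM0 : 0 ≤ M) {m : ℤ} (hm : m ≤ -4)
    (hM : ∀ z, 1 ≤ ‖z‖ → ‖Φ z‖ ≤ M * ‖z‖ ^ m) : ∃ M', HasDecay 4 M' Ψ := by
  obtain ⟨M₂, hM₂⟩ := (isCompact_closedBall (0 : (EuclideanSpace ℝ (Fin 3))) (r + 1)).exists_bound_of_continuousOn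
    hΨ.continuousOn
  have hM₂0 : 0 ≤ M₂ := (norm_nonneg _).trans (hM₂ 0 (by simp; linarith))
  refine ⟨M₂ * (r + 2) ^ 4 + 16 * M, hasDecay_iff_div.2 fun z => ?_⟩
  have h1 : 0 < 1 + ‖z‖ := by positivity
  by_cases hz : ‖z‖ ≤ r + 1
  · have hb := hM₂ z (mem_closedBall_zero_iff.2 hz)
    rw [le_div_iff₀ (by positivity)]
    have h2 : (1 + ‖z‖) ^ 4 ≤ (r + 2) ^ 4 := pow_le_pow_left₀ h1.le (by linarith) 4
    nlinarith [pow_nonneg h1.le 4, mul_nonneg hM₂0 (sub_nonneg.2 h2)]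
  · rw [not_le] at hz
    have hz1 : 1 ≤ ‖z‖ := by linarith
    rw [heq z (by linarith)]
    have hb := hM z hz1
    have hzm : ‖z‖ ^ m ≤ ‖z‖ ^ (-4 : ℤ) := zpow_le_zpow_right₀ hz1 hm
    have hz0 : 0 < ‖z‖ := one_pos.trans_le hz1
    have hz4 : ‖z‖ ^ (-4 : ℤ) ≤ 16 / (1 + ‖z‖) ^ 4 := by
      rw [show (-4 : ℤ) = -((4 : ℕ) : ℤ) by norm_num, zpow_neg, zpow_natCast, inv_eq_one_div,
        div_le_div_iff₀ (by positivity) (by positivity)]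
      have : (1 + ‖z‖) ^ 4 ≤ (2 * ‖z‖) ^ 4 := pow_le_pow_left₀ h1.le (by linarith) 4
      nlinarith
    have hmain : ‖Φ z‖ ≤ 16 * M / (1 + ‖z‖) ^ 4 := by
      calc ‖Φ z‖ ≤ M * ‖z‖ ^ m := hb
        _ ≤ M * ‖z‖ ^ (-4 : ℤ) := mul_le_mul_of_nonneg_left hzm hM0
        _ ≤ M * (16 / (1 + ‖z‖) ^ 4) := mul_le_mul_of_nonneg_left hz4 hM0
        _ = 16 * M / (1 + ‖z‖) ^ 4 := by ring
    refine hmain.trans ?_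
    rw [div_le_div_iff_of_pos_right (by positivity)]
    nlinarith [pow_nonneg (show (0:ℝ) ≤ r + 2 by linarith) 4]

variable {r₀ r₁ : ℝ}

/-- **`D³Γ∞` decays like `(1+|z|)⁻⁴`**: off the ball it is `D³Γ`, homogeneous of degree `−4`
(Gilbarg–Trudinger's derivative estimate (2.14), `|D^βΓ(z)| ≤ C|z|^{2−n−|β|}` with `n = 3`,
`|β| = 3`), inside it is bounded. In particular `D³Γ∞ ∈ L¹(ℝ³)`. [cite: GilbargTrudinger2001, (2.14)] -/
theorem exists_hasDecay_four_fderiv3_newtonFar (h₀ : 0 < r₀) (h₁ : r₀ < r₁) :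
    ∃ M, HasDecay 4 M (fderiv ℝ (fderiv ℝ (fderiv ℝ (newtonFar r₀ r₁)))) := by
  have hr1 : 0 ≤ r₁ := (h₀.trans h₁).le
  have hΓ : ContDiff ℝ ∞ (newtonFar r₀ r₁) := contDiff_newtonFar h₀ h₁
  have hc3 : Continuous (fderiv ℝ (fderiv ℝ (fderiv ℝ (newtonFar r₀ r₁)))) :=
    ((hΓ.fderiv_right (m := ∞) le_rfl).fderiv_right (m := ∞) le_rfl
      |>.fderiv_right (m := ∞) le_rfl).continuous
  have heq := fun z (hz : r₁ < ‖z‖) => newtonFar_fderiv_iterates_eq h₀.le h₁ hz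
  obtain ⟨M3, hM30, hM3⟩ := exists_decay_of_homogeneous _ (-4) (by norm_num)
    fderiv3_newtonKernel_homogeneous (contDiffOn_fderiv3_newtonKernel (n := 0)).continuousOn
  exact hasDecay_four_of_eqOn_far hc3 hr1 (fun z hz => (heq z hz).2.2.2.1) hM30 le_rfl hM3

/-! ### The mean-value majorant for differences of `D²Γ∞` -/

/-- **Peetre's inequality to the fourth power**: for `|ξ| ≤ ρ`,
`(1+|ξ−y|)⁻⁴ ≤ (1+ρ)⁴ (1+|y|)⁻⁴` (private helper). [folklore] -/
private theorem inv_one_add_norm_sub_pow_four_le {ξ y : (EuclideanSpace ℝ (Fin 3))} {ρ : ℝ} (hξ : ‖ξ‖ ≤ ρ) :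
    ((1 + ‖ξ - y‖) ^ 4)⁻¹ ≤ (1 + ρ) ^ 4 * ((1 + ‖y‖) ^ 4)⁻¹ := by
  have h1 : 0 < 1 + ‖ξ - y‖ := by positivity
  have h2 : 0 < 1 + ‖y‖ := by positivity
  have hρ : 0 ≤ ρ := (norm_nonneg ξ).trans hξ
  -- Peetre: `1 + |y| ≤ (1 + |ξ|)(1 + |ξ − y|) ≤ (1 + ρ)(1 + |ξ − y|)`
  have hp : 1 + ‖y‖ ≤ (1 + ρ) * (1 + ‖ξ - y‖) := by
    have hy : ‖y‖ ≤ ‖ξ‖ + ‖ξ - y‖ := norm_le_norm_add_norm_sub ξ y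
    nlinarith [norm_nonneg (ξ - y), norm_nonneg ξ]
  have hq : (1 + ‖y‖) ^ 4 ≤ ((1 + ρ) * (1 + ‖ξ - y‖)) ^ 4 := pow_le_pow_left₀ h2.le hp 4
  rw [← one_div, ← one_div, ← div_eq_mul_one_div, div_le_div_iff₀ (by positivity) (by positivity)]
  calc 1 * (1 + ‖y‖) ^ 4 = (1 + ‖y‖) ^ 4 := one_mul _
    _ ≤ ((1 + ρ) * (1 + ‖ξ - y‖)) ^ 4 := hq
    _ = (1 + ρ) ^ 4 * (1 + ‖ξ - y‖) ^ 4 := by ring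

/-- **The mean-value majorant**: there is `M ≥ 0` with
`‖D²Γ∞(x−y) − D²Γ∞(x'−y)‖ ≤ M (1+ρ)⁴ ‖x − x'‖ (1+|y|)⁻⁴` whenever `|x|, |x'| ≤ ρ` (mean value
inequality on the ball `B̄(0,ρ)` for `ξ ↦ D²Γ∞(ξ − y)`, whose derivative `D³Γ∞(ξ−y)` is at most
`M (1+|ξ−y|)⁻⁴ ≤ M(1+ρ)⁴(1+|y|)⁻⁴` there; Gilbarg–Trudinger (2.14) for the third derivatives of the
Newtonian kernel is the input). [cite: GilbargTrudinger2001, (2.14)] -/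
theorem exists_norm_fderiv2_newtonFar_sub_sub_le (h₀ : 0 < r₀) (h₁ : r₀ < r₁) :
    ∃ M, 0 ≤ M ∧ ∀ (ρ : ℝ) (x x' y : (EuclideanSpace ℝ (Fin 3))), ‖x‖ ≤ ρ → ‖x'‖ ≤ ρ →
      ‖fderiv ℝ (fderiv ℝ (newtonFar r₀ r₁)) (x - y) - fderiv ℝ (fderiv ℝ (newtonFar r₀ r₁)) (x' - y)‖ ≤
        M * (1 + ρ) ^ 4 * ‖x - x'‖ * ((1 + ‖y‖) ^ 4)⁻¹ := by
  obtain ⟨M, hM⟩ := exists_hasDecay_four_fderiv3_newtonFar h₀ h₁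
  have hM0 : 0 ≤ M := hM.nonneg
  set K := fderiv ℝ (fderiv ℝ (newtonFar r₀ r₁)) with hK
  have hKd : Differentiable ℝ K := (contDiff_fderiv2_newtonFar h₀ h₁).differentiable two_ne_zero
  refine ⟨M, hM0, fun ρ x x' y hx hx' => ?_⟩
  -- the function `ξ ↦ K (ξ - y)` on the convex set `closedBall 0 ρ`
  have hdiff : ∀ ξ ∈ closedBall (0 : (EuclideanSpace ℝ (Fin 3))) ρ, DifferentiableAt ℝ (fun ξ => K (ξ - y)) ξ := fun ξ _ =>
    (hKd (ξ - y)).comp ξ ((differentiableAt_id).sub (differentiableAt_const y))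
  have hbound : ∀ ξ ∈ closedBall (0 : (EuclideanSpace ℝ (Fin 3))) ρ,
      ‖fderiv ℝ (fun ξ => K (ξ - y)) ξ‖ ≤ M * (1 + ρ) ^ 4 * ((1 + ‖y‖) ^ 4)⁻¹ := by
    intro ξ hξ
    rw [mem_closedBall_zero_iff] at hξ
    have e : fderiv ℝ (fun ξ => K (ξ - y)) ξ = fderiv ℝ K (ξ - y) := by
      simpa only [sub_eq_add_neg] using fderiv_comp_add_right (f := K) (x := ξ) (-y)
    rw [e]
    calc ‖fderiv ℝ K (ξ - y)‖ ≤ M * ((1 + ‖ξ - y‖) ^ 4)⁻¹ := hM (ξ - y)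
      _ ≤ M * ((1 + ρ) ^ 4 * ((1 + ‖y‖) ^ 4)⁻¹) :=
          mul_le_mul_of_nonneg_left (inv_one_add_norm_sub_pow_four_le hξ) hM0
      _ = M * (1 + ρ) ^ 4 * ((1 + ‖y‖) ^ 4)⁻¹ := by ring
  have h := (convex_closedBall (0 : (EuclideanSpace ℝ (Fin 3))) ρ).norm_image_sub_le_of_norm_fderiv_le hdiff hbound
    (mem_closedBall_zero_iff.2 hx') (mem_closedBall_zero_iff.2 hx)
  calc ‖K (x - y) - K (x' - y)‖ ≤ M * (1 + ρ) ^ 4 * ((1 + ‖y‖) ^ 4)⁻¹ * ‖x - x'‖ := h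
    _ = M * (1 + ρ) ^ 4 * ‖x - x'‖ * ((1 + ‖y‖) ^ 4)⁻¹ := by ring

/-! ### The `L¹` translation modulus of `D²Γ∞` -/

/-- **The `L¹` translation modulus of `D²Γ∞` grows at most like `√(1+|d|)`**: there is `A ≥ 0`
with `∫ ‖D²Γ∞(z+d) − D²Γ∞(z)‖ dz ≤ A √(1+|d|)` for every `d` (and the integrand is integrable).
Far from the origin (`|z| ≥ 2(1+|d|)`) the mean value inequality and the decay of `D³Γ∞` give
`16 M₃ |d| (1+|z|)⁻⁴ ≤ 16 M₃ |d| (3+2|d|)^{-1/2} (1+|z|)^{-7/2}`; near the origin each term is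
at most `M₂ (1+|·|)⁻³ ≤ M₂ √(4+3|d|) (1+|·|)^{-7/2}`; and `(1+|z|)^{-7/2} ∈ L¹`. (The sharp
order is `log |d|`: the kernel of `RᵢRⱼ` on bounded data is a `BMO` object, Seregin 2014 Lemma 6.5;
the far-region half is Hörmander's condition `∫_{|z|≥2|d|} |K(z+d) − K(z)| dz ≤ B` for the
Calderón–Zygmund kernel `K = D²Γ` of `RᵢRⱼ`, Stein 1970, Ch. II §2 Thm 1 (b) / §3.)
[cite: Stein1970, Ch. II §2 Thm 1 condition (b) and §3 (the kernels `Ω(x)/|x|ⁿ`); Seregin2014, §6.2 Lemma 6.5] -/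
theorem exists_integral_norm_fderiv2_newtonFar_translate_sub_le (h₀ : 0 < r₀) (h₁ : r₀ < r₁) :
    ∃ A, 0 ≤ A ∧ ∀ d : (EuclideanSpace ℝ (Fin 3)),
      Integrable (fun z => ‖fderiv ℝ (fderiv ℝ (newtonFar r₀ r₁)) (z + d) -
        fderiv ℝ (fderiv ℝ (newtonFar r₀ r₁)) z‖) ∧
      ∫ z, ‖fderiv ℝ (fderiv ℝ (newtonFar r₀ r₁)) (z + d) - fderiv ℝ (fderiv ℝ (newtonFar r₀ r₁)) z‖ ≤
        A * Real.sqrt (1 + ‖d‖) := by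
  set K := fderiv ℝ (fderiv ℝ (newtonFar r₀ r₁)) with hK
  obtain ⟨⟨M₂, hM₂⟩, -, -⟩ := exists_hasDecay_fderiv_newtonFar h₀ h₁
  obtain ⟨M₃, hM₃⟩ := exists_hasDecay_four_fderiv3_newtonFar h₀ h₁
  have hM₂0 : 0 ≤ M₂ := hM₂.nonneg
  have hM₃0 : 0 ≤ M₃ := hM₃.nonneg
  have hKc : Continuous K := (contDiff_fderiv2_newtonFar h₀ h₁).continuous
  have hKd : Differentiable ℝ K := (contDiff_fderiv2_newtonFar h₀ h₁).differentiable two_ne_zero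
  -- the integrable weight `w(z) = (1+|z|)^{-7/2}`
  set w : (EuclideanSpace ℝ (Fin 3)) → ℝ := fun z => ((1 + ‖z‖) ^ 3 * Real.sqrt (1 + ‖z‖))⁻¹ with hw
  have hwi : Integrable w := integrable_inv_one_add_norm_pow_three_mul_sqrt
  have hw0 : ∀ z, 0 ≤ w z := fun z => by rw [hw]; positivity
  set I : ℝ := ∫ z, w z with hI
  have hI0 : 0 ≤ I := by rw [hI]; exact integral_nonneg hw0
  clear_value I
  refine ⟨16 * M₃ * I + 4 * M₂ * I, by positivity, fun d => ?_⟩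
  -- thresholds
  set s : ℝ := 2 * (1 + ‖d‖) with hs
  set s' : ℝ := 3 * (1 + ‖d‖) with hs'
  have hs0 : 0 ≤ s := by positivity
  have hs'0 : 0 ≤ s' := by positivity
  -- the dominating function
  set g : (EuclideanSpace ℝ (Fin 3)) → ℝ := fun z => 16 * M₃ * ‖d‖ * (Real.sqrt (1 + s))⁻¹ * w z +
    M₂ * Real.sqrt (1 + s') * (w (z + d) + w z) with hg
  have hgi : Integrable g := by
    refine ((hwi.const_mul _).add (((hwi.comp_add_right d).add hwi).const_mul _))
  -- the pointwise bound
  have hpt : ∀ z, ‖K (z + d) - K z‖ ≤ g z := by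
    intro z
    have hA0 : 0 ≤ 16 * M₃ * ‖d‖ * (Real.sqrt (1 + s))⁻¹ * w z := by
      have := hw0 z; positivity
    have hB0 : 0 ≤ M₂ * Real.sqrt (1 + s') * (w (z + d) + w z) := by
      have := hw0 z; have := hw0 (z + d); positivity
    by_cases hz : s ≤ ‖z‖
    · -- far region: mean value inequality on `closedBall z ‖d‖`
      have hfar : ∀ ξ ∈ closedBall z ‖d‖, ‖fderiv ℝ K ξ‖ ≤ 16 * M₃ * ((1 + ‖z‖) ^ 4)⁻¹ := by
        intro ξ hξ
        rw [mem_closedBall, dist_eq_norm] at hξ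
        have hξn : (1 + ‖z‖) / 2 ≤ 1 + ‖ξ‖ := by
          have : ‖z‖ ≤ ‖ξ‖ + ‖ξ - z‖ := by
            have := norm_add_le ξ (z - ξ); rw [add_sub_cancel] at this
            rwa [norm_sub_rev] at this
          rw [hs] at hz
          linarith
        have h1 : 0 < 1 + ‖z‖ := by positivity
        have h2 : 0 < 1 + ‖ξ‖ := by positivity
        have hpow : ((1 + ‖z‖) / 2) ^ 4 ≤ (1 + ‖ξ‖) ^ 4 := pow_le_pow_left₀ (by positivity) hξn 4
        calc ‖fderiv ℝ K ξ‖ ≤ M₃ * ((1 + ‖ξ‖) ^ 4)⁻¹ := hM₃ ξ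
          _ ≤ M₃ * (((1 + ‖z‖) / 2) ^ 4)⁻¹ := by
              refine mul_le_mul_of_nonneg_left ?_ hM₃0
              exact inv_anti₀ (by positivity) hpow
          _ = 16 * M₃ * ((1 + ‖z‖) ^ 4)⁻¹ := by field_simp; ring
      have hmv := (convex_closedBall z ‖d‖).norm_image_sub_le_of_norm_fderiv_le
        (fun ξ _ => hKd ξ) hfar (mem_closedBall_self (norm_nonneg d))
        (show z + d ∈ closedBall z ‖d‖ by simp [mem_closedBall, dist_eq_norm])
      rw [add_sub_cancel_left] at hmv
      have hstep : ((1 + ‖z‖) ^ 4)⁻¹ ≤ (Real.sqrt (1 + s))⁻¹ * w z :=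
        inv_pow_four_le_of_le hs0 hz
      calc ‖K (z + d) - K z‖ ≤ 16 * M₃ * ((1 + ‖z‖) ^ 4)⁻¹ * ‖d‖ := hmv
        _ = 16 * M₃ * ‖d‖ * ((1 + ‖z‖) ^ 4)⁻¹ := by ring
        _ ≤ 16 * M₃ * ‖d‖ * ((Real.sqrt (1 + s))⁻¹ * w z) :=
            mul_le_mul_of_nonneg_left hstep (by positivity)
        _ = 16 * M₃ * ‖d‖ * (Real.sqrt (1 + s))⁻¹ * w z := by ring
        _ ≤ g z := by rw [hg]; linarith
    · -- near region: each term separately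
      rw [not_le] at hz
      have hz' : ‖z‖ ≤ s' := by rw [hs']; rw [hs] at hz; linarith
      have hzd : ‖z + d‖ ≤ s' := by
        have := norm_add_le z d; rw [hs']; rw [hs] at hz; linarith
      have e1 : ((1 + ‖z + d‖) ^ 3)⁻¹ ≤ Real.sqrt (1 + s') * w (z + d) :=
        inv_pow_three_le_of_le (by linarith [norm_nonneg (z + d)]) hzd
      have e2 : ((1 + ‖z‖) ^ 3)⁻¹ ≤ Real.sqrt (1 + s') * w z :=
        inv_pow_three_le_of_le (by linarith [norm_nonneg z]) hz'
      calc ‖K (z + d) - K z‖ ≤ ‖K (z + d)‖ + ‖K z‖ := norm_sub_le _ _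
        _ ≤ M₂ * ((1 + ‖z + d‖) ^ 3)⁻¹ + M₂ * ((1 + ‖z‖) ^ 3)⁻¹ := add_le_add (hM₂ _) (hM₂ _)
        _ ≤ M₂ * (Real.sqrt (1 + s') * w (z + d)) + M₂ * (Real.sqrt (1 + s') * w z) := by
            gcongr
        _ = M₂ * Real.sqrt (1 + s') * (w (z + d) + w z) := by ring
        _ ≤ g z := by rw [hg]; linarith
  have hmeas : AEStronglyMeasurable (fun z => ‖K (z + d) - K z‖) volume :=
    ((hKc.comp (continuous_id.add continuous_const)).sub hKc).norm.aestronglyMeasurable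
  have hint : Integrable (fun z => ‖K (z + d) - K z‖) :=
    Integrable.mono' hgi hmeas (Eventually.of_forall fun z => by
      rw [Real.norm_eq_abs, abs_of_nonneg (norm_nonneg _)]; exact hpt z)
  refine ⟨hint, ?_⟩
  -- integrate the dominating function
  have i1 : Integrable (fun z => w (z + d)) := hwi.comp_add_right d
  have i2 : Integrable (fun z => w (z + d) + w z) := i1.add hwi
  have j1 : Integrable (fun z => 16 * M₃ * ‖d‖ * (Real.sqrt (1 + s))⁻¹ * w z) := hwi.const_mul _
  have j2 : Integrable (fun z => M₂ * Real.sqrt (1 + s') * (w (z + d) + w z)) := i2.const_mul _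
  have hwd : ∫ z, w (z + d) = I := by rw [hI]; exact integral_add_right_eq_self w d
  have hIg : ∫ z, g z = 16 * M₃ * ‖d‖ * (Real.sqrt (1 + s))⁻¹ * I +
      M₂ * Real.sqrt (1 + s') * (I + I) := by
    simp only [hg]
    rw [integral_add j1 j2, integral_const_mul, integral_const_mul, integral_add i1 hwi, hwd, ← hI]
  have hle : ∫ z, ‖K (z + d) - K z‖ ≤ ∫ z, g z := integral_mono hint hgi hpt
  -- elementary: `|d|/√(1+s) ≤ √(1+|d|)` and `√(1+s') ≤ 2√(1+|d|)`
  have hd0 : 0 ≤ ‖d‖ := norm_nonneg d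
  have hsq : 0 < Real.sqrt (1 + ‖d‖) := Real.sqrt_pos.2 (by positivity)
  have hsqs : 0 < Real.sqrt (1 + s) := Real.sqrt_pos.2 (by positivity)
  have e1 : ‖d‖ * (Real.sqrt (1 + s))⁻¹ ≤ Real.sqrt (1 + ‖d‖) := by
    rw [← div_eq_mul_inv, div_le_iff₀ hsqs, ← Real.sqrt_mul (by positivity)]
    refine Real.le_sqrt_of_sq_le ?_
    rw [hs]; nlinarith
  have e2 : Real.sqrt (1 + s') ≤ 2 * Real.sqrt (1 + ‖d‖) := by
    rw [show (2 : ℝ) = Real.sqrt (2 ^ 2) by rw [Real.sqrt_sq]; norm_num, ← Real.sqrt_mul (by norm_num)]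
    exact Real.sqrt_le_sqrt (by rw [hs']; nlinarith)
  calc ∫ z, ‖K (z + d) - K z‖ ≤ ∫ z, g z := hle
    _ = 16 * M₃ * I * (‖d‖ * (Real.sqrt (1 + s))⁻¹) + 2 * M₂ * I * Real.sqrt (1 + s') := by
        rw [hIg]; ring
    _ ≤ 16 * M₃ * I * Real.sqrt (1 + ‖d‖) + 2 * M₂ * I * (2 * Real.sqrt (1 + ‖d‖)) :=
        add_le_add (mul_le_mul_of_nonneg_left e1 (mul_nonneg (mul_nonneg (by norm_num) hM₃0) hI0))
          (mul_le_mul_of_nonneg_left e2 (mul_nonneg (mul_nonneg (by norm_num) hM₂0) hI0))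
    _ = (16 * M₃ * I + 4 * M₂ * I) * Real.sqrt (1 + ‖d‖) := by ring

end RieszPressureModConst

end Literature.Analysis.FluidPDE

end
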